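import Summits.CriticalPhenomena.PercolationContinuityZ3.Theorems.AdditiveGluing.Negative.CertPartition

/-!
# `AdditiveGluing` (crux stmt-CriticalPhenomena-4576, route `PercNearOneGluing`):
# the WITNESS checker — one `native_decide` turns a violating weighted graph into a certified
# violating instance of the inequality (hence, in two lines, into `¬ AdditiveGluing`)

The crux is finitely refutable: a single weighted graph with a relay set `A`, an observer `o` and a
target `b` such that `P(o ↔ A) − max_{a ∈ A} P(a ↮ b) > P(o ↔ b)` refutes it.  With the certified
partition checker of `CertPartition.lean` (exact rational probabilities `pConn`, `pNotConn`,
`pConnSet` of `prodBernoulli (wOfList l)`) this file packages that step once and for all: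

* `agPWitness n l o b Am : Bool` — the weights lie in `[0,1]`, the pairs are distinct, the relay mask
  `Am` is a non-empty subset of `Fin n`, and for EVERY `a ∈ A`:
  `pConn o b + pNotConn a b < pConnSet o A` (so in particular for the worst relay);
* `violation_of_agPWitness` — **`agPWitness n l o b Am = true` yields `A`, `t ≥ 0` with
  `1 − t ≤ P(a ↔ b)` for all `a ∈ A` and `P(o ↔ b) < P(o ↔ A) − t`** under `prodBernoulli (wOfList l)`
  (`A = finsetOfMask n Am`, `t = max_{a ∈ A} P(a ↮ b)`), i.e. exactly the data contradicting the body
  of the crux at `w = wOfList l`.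

So a future counterexample `l, o, b, A` found by any search is certified by
`theorem w : agPWitness n l o b Am = true := by native_decide`, and the route's refutation file is
then two lines: `theorem … : ¬ AdditiveGluing := fun h => by obtain ⟨A, t, ht, hrel, hlt⟩ :=
violation_of_agPWitness w; exact (hlt.trans_le (h n _ A o b t ht hrel)).false`.  No such witness is
known: every exhaustive block checked so far passes (`CertSoundness`, `CertIsoSix`, the kit jobs on
the item); `agPWitness_tightFamily6` records that the route's tight family is not one.  Nothing here
asserts or refutes the crux.
-/

namespace Summit.CriticalPhenomena.PercolationContinuityZ3.Theorems.AdditiveGluing.Negative.Cert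

open MeasureTheory
open Literature.Probability.Percolation Literature.Probability.LatticeModels

/-! ### The witness check (computable) -/

section Checker

/-- THE WITNESS CHECK: the weighted graph `l` with relay mask `Am`, observer `o` and target `b`
VIOLATES the additive gluing inequality — for every `a ∈ A`,
`P(o ↔ b) + P(a ↮ b) < P(o ↔ A)`. -/
def agPWitness (n : ℕ) (l : List (Fin n × Fin n × ℚ)) (o b Am : ℕ) : Bool :=
  (l.all fun e => decide (0 ≤ e.2.2) && decide (e.2.2 ≤ 1)) && decide (wPairs l).Nodup &&
  decide (Am < 2 ^ n) && !(Am == 0) &&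
  (List.range n).all fun a => !(Am.testBit a) ||
    decide (pConn (partDist n l) o b + pNotConn (partDist n l) a b < pConnSet n (partDist n l) o Am)

end Checker

/-- The relay set encoded by a bit mask. -/
def finsetOfMask (n Am : ℕ) : Finset (Fin n) := Finset.univ.filter fun a => Am.testBit a = true

/-- Membership in `finsetOfMask`. -/
theorem mem_finsetOfMask {n Am : ℕ} (a : Fin n) : a ∈ finsetOfMask n Am ↔ Am.testBit a = true := by
  simp [finsetOfMask]

/-- `maskL` inverts `finsetOfMask` below `2^n`. -/
theorem maskL_toList_finsetOfMask {n Am : ℕ} (hAm : Am < 2 ^ n) :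
    maskL (finsetOfMask n Am).toList = Am := by
  apply Nat.eq_of_testBit_eq
  intro i
  rw [Bool.eq_iff_iff, testBit_maskL]
  constructor
  · rintro ⟨a, ha, rfl⟩
    exact (mem_finsetOfMask a).1 (Finset.mem_toList.1 ha)
  · intro hi
    have hin : i < n := by
      by_contra hni
      have : Am < 2 ^ i := lt_of_lt_of_le hAm (Nat.pow_le_pow_right (by norm_num) (not_lt.1 hni))
      rw [Nat.testBit_lt_two_pow this] at hi
      exact Bool.false_ne_true hi
    exact ⟨⟨i, hin⟩, Finset.mem_toList.2 ((mem_finsetOfMask _).2 hi), rfl⟩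

/-- **A certified witness is a violating instance.** If `agPWitness n l o b Am = true` then, under
`prodBernoulli (wOfList l)`, the relay set `A = finsetOfMask n Am` and the slack
`t = max_{a ∈ A} P(a ↮ b) ≥ 0` satisfy the hypotheses of the additive gluing inequality while
`P(o ↔ b) < P(o ↔ A) − t` — the negation of its conclusion at `w = wOfList l`. -/
theorem violation_of_agPWitness {n : ℕ} {l : List (Fin n × Fin n × ℚ)} {o b : Fin n} {Am : ℕ}
    (h : agPWitness n l o b Am = true) :
    ∃ (A : Finset (Fin n)) (t : ℝ), 0 ≤ t ∧
      (∀ a ∈ A, 1 - t ≤ (prodBernoulli (wOfList l)).real (openConn a b)) ∧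
      (prodBernoulli (wOfList l)).real (openConn o b) <
        (prodBernoulli (wOfList l)).real (⋃ a ∈ A, openConn o a) - t := by
  classical
  simp only [agPWitness, Bool.and_eq_true, List.all_eq_true, decide_eq_true_eq, Bool.or_eq_true,
    Bool.not_eq_true', beq_eq_false_iff_ne, List.mem_range] at h
  obtain ⟨⟨⟨⟨hq, hnd⟩, hAm⟩, hAm0⟩, hall⟩ := h
  replace hq : ∀ e ∈ l, 0 ≤ e.2.2 ∧ e.2.2 ≤ 1 := fun e he => hq e he
  set A : Finset (Fin n) := finsetOfMask n Am with hA
  set d := partDist n l with hd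
  -- the relay set is non-empty
  have hAne : A.Nonempty := by
    obtain ⟨i, hi⟩ := Nat.exists_testBit_of_ne_zero hAm0
    have hin : i < n := by
      by_contra hni
      have : Am < 2 ^ i := lt_of_lt_of_le hAm (Nat.pow_le_pow_right (by norm_num) (not_lt.1 hni))
      rw [Nat.testBit_lt_two_pow this] at hi
      exact Bool.false_ne_true hi
    exact ⟨⟨i, hin⟩, (mem_finsetOfMask _).2 hi⟩
  -- the worst relay and the slack `t = P(a* ↮ b)`
  obtain ⟨aw, haw, hmax⟩ := Finset.exists_max_image A (fun a => pNotConn d a b) hAne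
  set t : ℝ := (pNotConn d aw b : ℝ) with ht
  have hPnot : ∀ a : Fin n, (prodBernoulli (wOfList l)).real (openConn a b) = 1 - (pNotConn d a b : ℝ) := by
    intro a
    rw [← real_compl_openConn_eq_pNotConn hnd hq a b,
      probReal_compl_eq_one_sub (measurableSet_openConn_holds a b)]
    ring
  have ht0 : 0 ≤ t := by
    rw [ht, ← real_compl_openConn_eq_pNotConn hnd hq aw b]
    exact measureReal_nonneg
  have hrel : ∀ a ∈ A, 1 - t ≤ (prodBernoulli (wOfList l)).real (openConn a b) := by
    intro a ha
    rw [hPnot a]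
    have : (pNotConn d a b : ℝ) ≤ t := by rw [ht]; exact_mod_cast hmax a ha
    linarith
  refine ⟨A, t, ht0, hrel, ?_⟩
  rw [real_iUnion_openConn_eq_pConnSet hnd hq, real_openConn_eq_pConn hnd hq, hA,
    maskL_toList_finsetOfMask hAm]
  have hlt := hall aw aw.2 |>.resolve_left (by
    rw [Bool.not_eq_false]
    exact (mem_finsetOfMask aw).1 haw)
  have hlt' : (pConn d o b : ℝ) + (pNotConn d aw b : ℝ) < (pConnSet n d o Am : ℝ) := by exact_mod_cast hlt
  rw [← hd]
  linarith

/-! ### The route's tight family is not a witness -/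

/-- On the asymptotically tight family of the route text (`tightFamily6` of `CertWeighted.lean`,
`o = 0`, `b = 5`, `A = {3, 4} =` the neighbours of `b`) the witness check FAILS, as it must
(`native_decide`). -/
theorem agPWitness_tightFamily6 : agPWitness 6 tightFamily6 0 5 (2 ^ 3 + 2 ^ 4) = false := by
  native_decide

end Summit.CriticalPhenomena.PercolationContinuityZ3.Theorems.AdditiveGluing.Negative.Cert
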